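import Literature.Probability.LatticeModels.VillainBondMoments
import Literature.Probability.LatticeModels.VillainMMPInequality
import HarnessLib

/-!
# Garban–Spencer's path estimator for the Villain interaction

C. Garban, T. Spencer, J. Math. Phys. **63** (2022) 093302 = arXiv:2109.01617, §2, proof of
Theorem 1.3, Step 1 ((2.9)–(2.10)), Lemma 2.5 and Remark 1 — for the VILLAIN interaction
(Remark 10), with the estimator `R(u) = ∑_s w_s λ_K^{-|T_s|} U_{T_s}(u)`, `λ_K = e^{-1/(2K)}`
(`BondSystem.villainEstimator`).  PROVED here, transcribing the tree's XY file
`NishimoriPathEstimator`: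

* `𝔼_K[R] = 1`, `𝔼_K[⟨θ̄_x θ_y⟩_u R(u)] = 1` ((2.10)), `𝔼_K[|R|²] ≤ ∑ w w' λ_K^{-2 overlap}`;
* `BondSystem.one_sub_villainDisorderAvg_villainExpect_cosDiff_le` —
  `1 − 𝔼_K[⟨cos(θ(x) − θ(y))⟩_{u,K}] ≤ (∑_{s,s'} w_s w_{s'} λ_K^{-2·overlap(T_s,T_{s'})} − 1)^{1/2}`;
* `BondSystem.one_sub_villainExpect_one_cosDiff_le` — by the Villain MMP inequality
  (`VillainMMPInequality`) the same lower bound for the PURE Villain model on any finite bond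
  system and any path ensemble.

## References

* C. Garban, T. Spencer, J. Math. Phys. 63 (2022) 093302, arXiv:2109.01617, §2: (2.9), (2.10),
  Lemma 2.5 and the display after it, Remark 1, Remark 10. [GarbanSpencer2022]
-/

noncomputable section

namespace Literature.Probability.LatticeModels

open MeasureTheory Finset TopologicalSpace Filter
open scoped BigOperators ComplexConjugate Topology
open Literature.MathematicalPhysics.QuantumFieldTheory

namespace BondSystem

variable {V ι : Type*} (G : BondSystem V ι) [Fintype ι] [Fintype V] {x y : V}
  {S : Type*} [Fintype S]

/-! ### The estimator: mean one, second moment controlled by overlaps -/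

omit [Fintype V] in
/-- The Villain estimator is continuous in the disorder. [folklore] -/
theorem continuous_villainEstimator (K : ℝ) (w : S → ℝ) (T : S → G.UnitChain x y) :
    Continuous (G.villainEstimator K w T) :=
  continuous_finsetSum _ fun s _ => continuous_const.mul (T s).continuous_holonomy

omit [Fintype V] in
/-- **`𝔼_K[R] = 1`** for probability weights (by `𝔼_K[U_T] = λ_K^{|T|₁}`).
[cite: GarbanSpencer2022, display after (2.10), with Remark 10] -/
theorem villainDisorderAvg_villainEstimator {K : ℝ} (hK : 0 < K) (w : S → ℝ) (hw1 : ∑ s, w s = 1)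
    (T : S → G.UnitChain x y) : villainDisorderAvg K (G.villainEstimator K w T) = 1 := by
  have hl := (villainMean_pos K).ne'
  unfold villainEstimator
  rw [villainDisorderAvg_finset_sum hK Finset.univ
    (Φ := fun s u => ((w s * (villainMean K)⁻¹ ^ (T s).length : ℝ) : ℂ) * (T s).holonomy u)
    fun s _ => continuous_const.mul (T s).continuous_holonomy]
  simp_rw [villainDisorderAvg_const_mul, G.villainDisorderAvg_holonomy hK]
  rw [← Complex.ofReal_one, ← hw1, Complex.ofReal_sum]
  refine Finset.sum_congr rfl fun s _ => ?_
  push_cast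
  rw [mul_assoc, ← mul_pow, inv_mul_cancel₀ (by exact_mod_cast hl), one_pow, mul_one]

/-- **Garban–Spencer (2.10) for the Villain interaction**: `𝔼_K[⟨θ̄_x θ_y⟩_{u,K} R(u)] = 1` for
probability weights. [cite: GarbanSpencer2022, (2.10) with Remark 10] -/
theorem villainDisorderAvg_villainCExpect_mul_villainEstimator {K : ℝ} (hK : 0 < K) (w : S → ℝ)
    (hw1 : ∑ s, w s = 1) (T : S → G.UnitChain x y) :
    villainDisorderAvg K (fun u => G.villainCExpect K u (fun θ => ((diffChar x y θ : Circle) : ℂ)) *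
      G.villainEstimator K w T u) = 1 := by
  have hl := (villainMean_pos K).ne'
  have hc : Continuous fun u => G.villainCExpect K u (fun θ => ((diffChar x y θ : Circle) : ℂ)) :=
    G.continuous_villainCExpect hK (continuous_subtype_val.comp
      ((map_continuous (diffChar x y)).comp continuous_snd))
  unfold villainEstimator
  simp_rw [Finset.mul_sum]
  rw [villainDisorderAvg_finset_sum hK Finset.univ
    (Φ := fun s u => G.villainCExpect K u (fun θ => ((diffChar x y θ : Circle) : ℂ)) *
      (((w s * (villainMean K)⁻¹ ^ (T s).length : ℝ) : ℂ) * (T s).holonomy u))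
    fun s _ => hc.mul (continuous_const.mul (T s).continuous_holonomy)]
  have e : ∀ s (u : ι → Circle), G.villainCExpect K u (fun θ => ((diffChar x y θ : Circle) : ℂ)) *
      (((w s * (villainMean K)⁻¹ ^ (T s).length : ℝ) : ℂ) * (T s).holonomy u) =
      ((w s * (villainMean K)⁻¹ ^ (T s).length : ℝ) : ℂ) *
        (G.villainCExpect K u (fun θ => ((diffChar x y θ : Circle) : ℂ)) * (T s).holonomy u) := by
    intro s u; ring
  simp_rw [e, villainDisorderAvg_const_mul, G.villainDisorderAvg_villainCExpect_diff_mul_holonomy hK]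
  rw [← Complex.ofReal_one, ← hw1, Complex.ofReal_sum]
  refine Finset.sum_congr rfl fun s _ => ?_
  push_cast
  rw [mul_assoc, ← mul_pow, inv_mul_cancel₀ (by exact_mod_cast hl), one_pow, mul_one]

omit [Fintype V] in
/-- **The second moment of the estimator (Lemma 2.5, first display, Villain interaction)**:
`𝔼_K[|R|²] ≤ ∑_{s,s'} w_s w_{s'} λ_K^{-2 overlap(T_s, T_{s'})}` for non-negative weights.
[cite: GarbanSpencer2022, proof of Lemma 2.5, first display, with Remark 10] -/
theorem villainDisorderAvg_norm_sq_villainEstimator_le {K : ℝ} (hK : 0 < K) (w : S → ℝ)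
    (hw : ∀ s, 0 ≤ w s) (T : S → G.UnitChain x y) :
    villainDisorderAvg K (fun u => ‖G.villainEstimator K w T u‖ ^ 2) ≤
      ∑ s, ∑ s', w s * w s' * ((villainMean K) ^ 2)⁻¹ ^ (T s).overlap (T s') := by
  have hl := villainMean_pos K
  set c : S → ℝ := fun s => w s * (villainMean K)⁻¹ ^ (T s).length with hc
  have hc0 : ∀ s, 0 ≤ c s := fun s => mul_nonneg (hw s) (pow_nonneg (inv_nonneg.2 hl.le) _)
  -- |R|² = Re (R R̄) = Re ∑∑ c c' U_s Ū_{s'}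
  have hsq : ∀ u, ‖G.villainEstimator K w T u‖ ^ 2 =
      (∑ s, ∑ s', ((c s * c s' : ℝ) : ℂ) * ((T s).holonomy u * conj ((T s').holonomy u))).re := by
    intro u
    have hn : (Complex.normSq (G.villainEstimator K w T u) : ℝ) =
        (G.villainEstimator K w T u * conj (G.villainEstimator K w T u)).re := by
      rw [Complex.mul_conj, Complex.ofReal_re]
    rw [← Complex.normSq_eq_norm_sq, hn]
    congr 1
    rw [villainEstimator, map_sum, Finset.sum_mul_sum]
    simp only [hc]
    refine Finset.sum_congr rfl fun s _ => Finset.sum_congr rfl fun s' _ => ?_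
    rw [map_mul, Complex.conj_ofReal]
    push_cast
    ring
  have hcont : ∀ s s', Continuous fun u : ι → Circle =>
      ((c s * c s' : ℝ) : ℂ) * ((T s).holonomy u * conj ((T s').holonomy u)) := fun s s' =>
    continuous_const.mul ((T s).continuous_holonomy.mul
      (Complex.continuous_conj.comp (T s').continuous_holonomy))
  simp_rw [hsq]
  rw [← re_villainDisorderAvg hK (continuous_finsetSum _ fun s _ => continuous_finsetSum _ fun s' _ => hcont s s'),
    villainDisorderAvg_finset_sum hK _ (fun s _ => continuous_finsetSum _ fun s' _ => hcont s s'),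
    Complex.re_sum]
  refine Finset.sum_le_sum fun s _ => ?_
  rw [villainDisorderAvg_finset_sum hK _ (fun s' _ => hcont s s'), Complex.re_sum]
  refine Finset.sum_le_sum fun s' _ => ?_
  obtain ⟨m, hm0, hm1, hm⟩ := G.villainDisorderAvg_holonomy_mul_conj hK (T s) (T s')
  rw [villainDisorderAvg_const_mul, hm, ← Complex.ofReal_mul, Complex.ofReal_re]
  -- c c' m ≤ c c' λ^{sd} = w w' λ^{-2 ov}
  calc c s * c s' * m ≤ c s * c s' * villainMean K ^ (T s).symmDiffCard (T s') :=
        mul_le_mul_of_nonneg_left hm1 (mul_nonneg (hc0 s) (hc0 s'))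
    _ = w s * w s' * ((villainMean K) ^ 2)⁻¹ ^ (T s).overlap (T s') := by
        have hlen := (T s).length_add_length (T s')
        have key : (villainMean K)⁻¹ ^ (T s).length * (villainMean K)⁻¹ ^ (T s').length =
            (villainMean K)⁻¹ ^ (T s).symmDiffCard (T s') *
              ((villainMean K) ^ 2)⁻¹ ^ (T s).overlap (T s') := by
          rw [← pow_add, hlen, pow_add, pow_mul, inv_pow (villainMean K) 2]
        have k2 : (villainMean K)⁻¹ ^ (T s).symmDiffCard (T s') *
            villainMean K ^ (T s).symmDiffCard (T s') = 1 := by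
          rw [← mul_pow, inv_mul_cancel₀ hl.ne', one_pow]
        simp only [hc]
        calc w s * (villainMean K)⁻¹ ^ (T s).length * (w s' * (villainMean K)⁻¹ ^ (T s').length) *
              villainMean K ^ (T s).symmDiffCard (T s')
            = w s * w s' * (((villainMean K)⁻¹ ^ (T s).length * (villainMean K)⁻¹ ^ (T s').length) *
                villainMean K ^ (T s).symmDiffCard (T s')) := by ring
          _ = w s * w s' * (((villainMean K)⁻¹ ^ (T s).symmDiffCard (T s') *
                villainMean K ^ (T s).symmDiffCard (T s')) *
                ((villainMean K) ^ 2)⁻¹ ^ (T s).overlap (T s')) := by rw [key]; ring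
          _ = _ := by rw [k2, one_mul]

/-! ### The lower bound on the two-point function -/

/-- **Garban–Spencer, end of Step 1, for the Villain interaction**: for every `K > 0`, every pair of
vertices and every path ensemble (probability weights `w` on unit chains `T_s` from `x` to `y`),
`1 − 𝔼_K[⟨cos(θ(x) − θ(y))⟩_{u,K}] ≤ (∑_{s,s'} w_s w_{s'} λ_K^{-2 overlap(T_s,T_{s'})} − 1)^{1/2}`.
[cite: GarbanSpencer2022, proof of Theorem 1.3, Step 1, display after Lemma 2.5, with Remark 10] -/
theorem one_sub_villainDisorderAvg_villainExpect_cosDiff_le {K : ℝ} (hK : 0 < K) (w : S → ℝ)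
    (hw : ∀ s, 0 ≤ w s) (hw1 : ∑ s, w s = 1) (T : S → G.UnitChain x y) :
    1 - villainDisorderAvg K (fun u => G.villainExpect K u (cosDiff x y)) ≤
      Real.sqrt (∑ s, ∑ s', w s * w s' * ((villainMean K) ^ 2)⁻¹ ^ (T s).overlap (T s') - 1) := by
  set R := G.villainEstimator K w T with hR
  set C : (ι → Circle) → ℂ := fun u => G.villainCExpect K u (fun θ => ((diffChar x y θ : Circle) : ℂ))
    with hC
  have hRc : Continuous R := G.continuous_villainEstimator K w T
  have hdc : Continuous (Function.uncurry fun (_ : ι → Circle) (θ : V → Circle) =>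
      ((diffChar x y θ : Circle) : ℂ)) :=
    continuous_subtype_val.comp ((map_continuous (diffChar x y)).comp continuous_snd)
  have hCc : Continuous C := G.continuous_villainCExpect hK hdc
  have hC1 : ∀ u, ‖C u‖ ≤ 1 := fun u =>
    G.norm_villainCExpect_le hK u _ fun θ => (Circle.norm_coe _).le
  -- the real two-point function is the real part of `C`
  have hre : ∀ u, G.villainExpect K u (cosDiff x y) = (C u).re := by
    intro u
    rw [hC, G.re_villainCExpect hK u (F := fun θ => ((diffChar x y θ : Circle) : ℂ))
      (continuous_subtype_val.comp (map_continuous (diffChar x y)))]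
    congr 1; funext θ; exact cosDiff_eq_reChar x y θ
  -- 1 − 𝔼 Re C = Re 𝔼[C (R − 1)]
  have h1 : 1 - villainDisorderAvg K (fun u => G.villainExpect K u (cosDiff x y)) =
      (villainDisorderAvg K (fun u => C u * (R u - 1))).re := by
    simp_rw [hre, mul_sub, mul_one]
    rw [villainDisorderAvg_sub hK (Φ := fun u => C u * R u) (Ψ := C) (hCc.mul hRc) hCc, Complex.sub_re,
      hR, hC, G.villainDisorderAvg_villainCExpect_mul_villainEstimator hK w hw1 T, Complex.one_re, ← hC,
      ← re_villainDisorderAvg hK hCc]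
  -- Re 𝔼[C(R−1)] ≤ 𝔼 |R − 1|
  have h2 : (villainDisorderAvg K (fun u => C u * (R u - 1))).re ≤
      villainDisorderAvg K (fun u => ‖R u - 1‖) := by
    refine (Complex.re_le_norm _).trans ((norm_villainDisorderAvg_le hK _).trans ?_)
    refine villainDisorderAvg_mono hK (Φ := fun u => ‖C u * (R u - 1)‖) (Ψ := fun u => ‖R u - 1‖)
      ((hCc.mul (hRc.sub continuous_const)).norm) (hRc.sub continuous_const).norm fun u => ?_
    rw [norm_mul]
    exact mul_le_of_le_one_left (norm_nonneg _) (hC1 u)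
  -- 𝔼|R − 1|² ≤ 𝔼|R|² − 1 (Jensen, and 𝔼 R = 1)
  have h3 : villainDisorderAvg K (fun u => ‖R u - 1‖) ^ 2 ≤ villainDisorderAvg K (fun u => ‖R u‖ ^ 2) - 1 := by
    refine (villainDisorderAvg_sq_le hK (g := fun u => ‖R u - 1‖) (hRc.sub continuous_const).norm).trans_eq ?_
    have e : (fun u => ‖R u - 1‖ ^ 2) = fun u => (‖R u‖ ^ 2 - 2 * (R u).re) + 1 := by
      funext u
      rw [← Complex.normSq_eq_norm_sq, ← Complex.normSq_eq_norm_sq, Complex.normSq_sub]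
      simp only [map_one, mul_one]
      ring
    rw [e, villainDisorderAvg_add hK (Φ := fun u => ‖R u‖ ^ 2 - 2 * (R u).re) (Ψ := fun _ => (1 : ℝ))
        ((hRc.norm.pow 2).sub (continuous_const.mul (Complex.continuous_re.comp hRc))) continuous_const,
      villainDisorderAvg_sub hK (Φ := fun u => ‖R u‖ ^ 2) (Ψ := fun u => 2 * (R u).re) (hRc.norm.pow 2)
        (continuous_const.mul (Complex.continuous_re.comp hRc)),
      villainDisorderAvg_const_mul_real K 2 (fun u => (R u).re), ← re_villainDisorderAvg hK hRc, hR,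
      G.villainDisorderAvg_villainEstimator hK w hw1 T, villainDisorderAvg_const hK]
    norm_num; ring
  have h4 := G.villainDisorderAvg_norm_sq_villainEstimator_le hK w hw T
  rw [← hR] at h4
  have h0 : 0 ≤ villainDisorderAvg K (fun u => ‖R u - 1‖) :=
    villainDisorderAvg_nonneg hK fun u => norm_nonneg _
  rw [h1]
  calc (villainDisorderAvg K (fun u => C u * (R u - 1))).re ≤ villainDisorderAvg K (fun u => ‖R u - 1‖) := h2
    _ = Real.sqrt (villainDisorderAvg K (fun u => ‖R u - 1‖) ^ 2) := (Real.sqrt_sq h0).symm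
    _ ≤ Real.sqrt (villainDisorderAvg K (fun u => ‖R u‖ ^ 2) - 1) := Real.sqrt_le_sqrt h3
    _ ≤ _ := Real.sqrt_le_sqrt (by linarith [h4])

/-- **Garban–Spencer, Theorem 1.3 ∘ Remark 1, deterministic part, for the Villain interaction.**
For the pure Villain model (`u ≡ 1`) on any finite bond system at stiffness `K > 0`, any two
vertices `x, y` and any path ensemble (probability weights `w` on unit chains `T_s` from `x` to `y`):
`⟨cos(θ(x) − θ(y))⟩_{1,K} ≥ 1 − (∑_{s,s'} w_s w_{s'} (λ_K²)^{-overlap(T_s,T_{s'})} − 1)^{1/2}`,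
`λ_K = e^{−1/(2K)}` (MMP: the pure model dominates the Nishimori average, which is bounded by the
estimator). [cite: GarbanSpencer2022, Theorem 1.3 with Remark 1, Remark 10 and Lemma 2.5] -/
theorem one_sub_villainExpect_one_cosDiff_le {K : ℝ} (hK : 0 < K) (x y : V) (w : S → ℝ)
    (hw : ∀ s, 0 ≤ w s) (hw1 : ∑ s, w s = 1) (T : S → G.UnitChain x y) :
    1 - G.villainExpect K 1 (cosDiff x y) ≤
      Real.sqrt (∑ s, ∑ s', w s * w s' * ((villainMean K) ^ 2)⁻¹ ^ (T s).overlap (T s') - 1) := by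
  have hmmp : villainDisorderAvg K (fun u => G.villainExpect K u (cosDiff x y)) ≤
      G.villainExpect K 1 (cosDiff x y) := by
    refine villainDisorderAvg_le_const hK ?_ fun u => G.villainExpect_cosDiff_le_villainExpect_one hK u x y
    have hdc : Continuous (Function.uncurry fun (_ : ι → Circle) (θ : V → Circle) =>
        ((diffChar x y θ : Circle) : ℂ)) :=
      continuous_subtype_val.comp ((map_continuous (diffChar x y)).comp continuous_snd)
    have hCc := G.continuous_villainCExpect hK hdc
    have e : (fun u => G.villainExpect K u (cosDiff x y)) =
        fun u => (G.villainCExpect K u (fun θ => ((diffChar x y θ : Circle) : ℂ))).re := by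
      funext u
      rw [G.re_villainCExpect hK u (F := fun θ => ((diffChar x y θ : Circle) : ℂ))
        (continuous_subtype_val.comp (map_continuous (diffChar x y)))]
      congr 1; funext θ; exact cosDiff_eq_reChar x y θ
    rw [e]
    exact Complex.continuous_re.comp hCc
  linarith [G.one_sub_villainDisorderAvg_villainExpect_cosDiff_le hK w hw hw1 T]

end BondSystem

end Literature.Probability.LatticeModels
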